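import Summits.Ventures.CertifiedManyBodySolver.Observables.StiffnessNoFloor
import HarnessLib

/-!
# Where the odd-moment road ends: the top current moment is free, `m₅` alone adds nothing to the K3 stiffness
# ceiling, and the next level needs `m₅` AND `m₇` (odd moments help in pairs)

HONEST FRAMING: one-sided certified stiffness CEILINGS are what the cell produces; this file decides which FURTHER ceiling
functionals exist on a thermodynamic-limit host and what they would cost — it proves no number about `ρ_s` and is not a
superconductivity verdict. Pure measure theory on the current spectral measure (dictionary in
`Observables/StiffnessNoFloor.lean`: Kohn `ρ_s L² = K − M₋₁`, `M₋₁ = ∫ x⁻¹ dμ_𝒥`, `m_k = ∫ x^k dμ_𝒥`; on a TL host only the ODD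
moments `m₁, m₃, m₅, …` are local = nested commutators, Observables/StiffnessTLOddMomentIdentification.lean); zero compute;
NO definition, no named fact, no `sorry`. Cell hubbard-obs (D-0042 crew 1), seat hubbard-obs-p2 (STIFFNESS), gen 7
(`prover-hubbard-obs-p2-g7-0`); companion of `StiffnessNoFloor.lean` (p415942/p417108: no FLOOR from moment windows; the
ceiling-side inequalities `m₀² ≤ M₋₁m₁`, `m₁² ≤ M₋₁m₃`). Answers TARGET.md K4 («a ground-state-functional handle beyond f-sum /
K3?», lead, due 2026-08-26) on the odd-moment axis: HOME/hubbard-obs-p2/STIFFNESS-LINE.md v2 §7.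

* `exists_raise_topMoment_invMoment_le` — the TOP moment of any finite list can be raised by any amount `c ≥ 0` EXACTLY, at
  cost `≤ ε` in every lower moment and in `M₋₁` (mass `c/b^k` at `b = max 1 (c/ε)`): the infimum of `M₋₁` under moment data
  is NON-INCREASING in the top moment, so only an UPPER bound on the top moment of a list can bind.
* `sq_thirdMoment_le_firstMoment_mul_fifthMoment` — `m₃² ≤ m₁ m₅` on `(0,∞)`: the K3-extremal one-atom shape (equality in
  `m₁² ≤ M₋₁ m₃`) already has the LEAST admissible `m₅`; hence
* `exists_fifthMoment_eq_invMoment_le_k3` — «`m₅` ALONE ADDS NOTHING»: for the K3-extremal atom `w δ_a` and ANY admissible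
  target `t ≥ w a⁵` there is a measure on `(0,∞)` with `(m₁, m₃)` within `ε`, `m₅ = t` exactly and `M₋₁ ≤ m₁²/m₃ + ε`. A
  certified row on the fifth current moment (depth-5 nested commutator, fermion words of degree ≤ 12), added to the K3 data
  `(d1U, m3T, m3U)`, cannot lift the correction to the stiffness ceiling above `m₁²/m₃`.
* `sq_oddPair_le_invMoment_mul` — what the NEXT odd level buys and costs: for all real `α, β`,
  `(α m₁ + β m₃)² ≤ M₋₁ (α² m₃ + 2αβ m₅ + β² m₇)` (Cauchy–Schwarz in the `(H − E₀)`-metric with the odd trial vector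
  `(α(H−E₀) + β(H−E₀)³)𝒥ψ₀`; `β = 0` is K3); optimising `(α, β)` is the 2-node Gauss floor
  `M₋₁ ≥ vᵀ[[m₃,m₅],[m₅,m₇]]⁻¹v`, `v = (m₁, m₃)`, strictly above `m₁²/m₃` unless `μ_𝒥` is one atom — and it needs `m₅` AND
  `m₇` (depth-7 commutator: words of degree ≤ 16 over ≈ 8–9 sites, outside every host of the programme: EXT5-L⁺ carries
  degree ≤ 8 on extent ≤ 5). ODD MOMENTS HELP IN PAIRS; the programme's odd-moment road ends at K3.

References: E. Lipparini, *Modern Many-Particle Physics* (2008), §8.4 eqs. (8.30)–(8.33) [Lipparini2008]; the moment-space facts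
are folklore (Shohat–Tamarkin 1943 Ch. II; Krein–Nudelman, *The Markov Moment Problem* (1977), Ch. III principal representations).
-/

noncomputable section

open MeasureTheory Filter Set
open scoped ENNReal BigOperators

namespace Summit.Ventures.CertifiedManyBodySolver.Observables

/-! ### The top moment is free -/

/-- **Raising the top moment is free.** For every finite measure `μ` on `ℝ` with `x⁻¹ ∈ L¹(μ)`, every exponent `k`
(`x^k ∈ L¹(μ)`), every `c ≥ 0` and `ε > 0` there are `w ≥ 0`, `b ≥ 1` such that `ν = μ + w δ_b` has
`∫ x^k dν = ∫ x^k dμ + c` EXACTLY, `|∫ x^j dν − ∫ x^j dμ| ≤ ε` for every `j < k` with `x^j ∈ L¹(μ)`, and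
`∫ x⁻¹ dν ≤ ∫ x⁻¹ dμ + ε` (take `b = max 1 (c/ε)`, `w = c/b^k`). Consequently the infimum of `M₋₁` under any finite
list of moment data is non-increasing in the list's top moment. [folklore] -/
theorem exists_raise_topMoment_invMoment_le (μ : Measure ℝ) [IsFiniteMeasure μ]
    (hinv : Integrable (fun x : ℝ => x⁻¹) μ) (k : ℕ) (hk : Integrable (fun x : ℝ => x ^ k) μ)
    {c : ℝ} (hc : 0 ≤ c) {ε : ℝ} (hε : 0 < ε) :
    ∃ w b : ℝ, 0 ≤ w ∧ 1 ≤ b ∧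
      ∫ x, x ^ k ∂(μ + (Real.toNNReal w) • Measure.dirac b) = (∫ x, x ^ k ∂μ) + c ∧
      (∀ j : ℕ, j < k → Integrable (fun x : ℝ => x ^ j) μ →
        |(∫ x, x ^ j ∂(μ + (Real.toNNReal w) • Measure.dirac b)) - ∫ x, x ^ j ∂μ| ≤ ε) ∧
      ∫ x, x⁻¹ ∂(μ + (Real.toNNReal w) • Measure.dirac b) ≤ (∫ x, x⁻¹ ∂μ) + ε := by
  set b : ℝ := max 1 (c / ε) with hb
  have hb1 : 1 ≤ b := le_max_left _ _
  have hb0 : 0 < b := one_pos.trans_le hb1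
  have hcb : c / b ≤ ε := by
    rw [div_le_iff₀ hb0]
    calc c = ε * (c / ε) := (mul_div_cancel₀ c hε.ne').symm
      _ ≤ ε * b := by gcongr; exact le_max_right _ _
  have hcb' : ∀ d : ℕ, c / b ^ (d + 1) ≤ ε := fun d => by
    refine le_trans ?_ hcb
    apply div_le_div_of_nonneg_left hc hb0
    calc b = b ^ 1 := (pow_one b).symm
      _ ≤ b ^ (d + 1) := pow_le_pow_right₀ hb1 (by omega)
  have hw0 : 0 ≤ c / b ^ k := div_nonneg hc (pow_nonneg hb0.le k)
  refine ⟨c / b ^ k, b, hw0, hb1, ?_, fun j hj hjint => ?_, ?_⟩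
  · rw [integral_add_pointMass μ hk hw0 b, div_mul_cancel₀ c (pow_ne_zero k hb0.ne')]
  · rw [integral_add_pointMass μ hjint hw0 b, add_sub_cancel_left,
      abs_of_nonneg (mul_nonneg hw0 (pow_nonneg hb0.le j))]
    obtain ⟨d, rfl⟩ := Nat.exists_eq_add_of_lt hj
    have h1 : c / b ^ (j + d + 1) * b ^ j = c / b ^ (d + 1) := by
      rw [show j + d + 1 = j + (d + 1) by ring, pow_add]
      field_simp
    rw [h1]
    exact hcb' d
  · rw [integral_add_pointMass μ hinv hw0 b, add_le_add_iff_left]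
    have h1 : c / b ^ k * b⁻¹ = c / b ^ (k + 1) := by
      rw [pow_succ]
      field_simp
    rw [h1]
    exact hcb' k

/-! ### `m₅` alone adds nothing to K3 -/

/-- Pointwise AM–GM behind `m₃² ≤ m₁ m₅`: `2x³ ≤ t x + x⁵/t` for `x, t > 0`. [folklore] -/
theorem two_mul_cube_le_mul_add_fifth_div {x t : ℝ} (hx : 0 < x) (ht : 0 < t) :
    2 * x ^ 3 ≤ t * x + x ^ 5 / t := by
  have ht0 : t ≠ 0 := ht.ne'
  have key : t * x + x ^ 5 / t - 2 * x ^ 3 = x * (t - x ^ 2) ^ 2 / t := by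
    field_simp
    ring
  have hnn : 0 ≤ x * (t - x ^ 2) ^ 2 / t := by positivity
  linarith

/-- **The K3-extremal shape minimises `m₅`:** for a finite measure `ν` carried by `(0,∞)` with `x, x³, x⁵ ∈ L¹(ν)`,
`(∫ x³ dν)² ≤ (∫ x dν)(∫ x⁵ dν)`, i.e. `m₃² ≤ m₁ m₅`, with equality for one atom. So the one-atom measure that realises
the K3 floor `M₋₁ = m₁²/m₃` has the least fifth moment compatible with its `(m₁, m₃)`; together with
`exists_raise_topMoment_invMoment_le` (the floor is non-increasing in `m₅`) the datum `m₅` cannot raise the floor.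
[cite: Lipparini2008, §8.4 eqs. (8.30)–(8.33)] -/
theorem sq_thirdMoment_le_firstMoment_mul_fifthMoment (ν : Measure ℝ) [IsFiniteMeasure ν] (hpos : ν (Iic 0) = 0)
    (h1 : Integrable (fun x : ℝ => x) ν) (h3 : Integrable (fun x : ℝ => x ^ 3) ν)
    (h5 : Integrable (fun x : ℝ => x ^ 5) ν) :
    (∫ x, x ^ 3 ∂ν) ^ 2 ≤ (∫ x, x ∂ν) * ∫ x, x ^ 5 ∂ν := by
  have hae : ∀ᵐ x ∂ν, 0 < x := by
    have h := (measure_eq_zero_iff_ae_notMem (μ := ν) (s := Iic 0)).1 hpos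
    filter_upwards [h] with x hx
    simpa using hx
  have h10 : 0 ≤ ∫ x, x ∂ν := integral_nonneg_of_ae (by filter_upwards [hae] with x hx; exact hx.le)
  have h30 : 0 ≤ ∫ x, x ^ 3 ∂ν :=
    integral_nonneg_of_ae (by filter_upwards [hae] with x hx; exact pow_nonneg hx.le 3)
  have h50 : 0 ≤ ∫ x, x ^ 5 ∂ν :=
    integral_nonneg_of_ae (by filter_upwards [hae] with x hx; exact pow_nonneg hx.le 5)
  refine sq_le_mul_of_forall_two_mul_le h30 h10 h50 fun t ht => ?_
  have hle : (fun x : ℝ => 2 * x ^ 3) ≤ᵐ[ν] fun x => t * x + x ^ 5 / t := by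
    filter_upwards [hae] with x hx
    exact two_mul_cube_le_mul_add_fifth_div hx ht
  have hint : Integrable (fun x : ℝ => t * x + x ^ 5 / t) ν := (h1.const_mul t).add (h5.div_const t)
  have hmono := integral_mono_ae (h3.const_mul 2) hint hle
  rw [integral_const_mul, integral_add (h1.const_mul t) (h5.div_const t), integral_const_mul,
    integral_div] at hmono
  linarith

/-- Integration against one atom: `∫ f d(w δ_a) = w f(a)` (`w ≥ 0`). [folklore] -/
theorem integral_pointMass {f : ℝ → ℝ} {w : ℝ} (hw : 0 ≤ w) (a : ℝ) :
    ∫ x, f x ∂((Real.toNNReal w) • Measure.dirac a) = w * f a := by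
  rw [integral_smul_nnreal_measure, integral_dirac, NNReal.smul_def, Real.coe_toNNReal w hw, smul_eq_mul]

/-- One atom at `a > 0` is carried by `(0,∞)`. [folklore] -/
theorem pointMass_Iic_zero (w : ℝ) {a : ℝ} (ha : 0 < a) :
    ((Real.toNNReal w) • Measure.dirac a) (Iic 0) = 0 := by
  have hx : a ∉ Iic (0 : ℝ) := by simpa using ha
  rw [Measure.smul_apply, (MeasureTheory.dirac_eq_zero_iff_not_mem measurableSet_Iic).2 hx, smul_zero]

/-- **`m₅` alone adds nothing to K3.** The one-atom measure `μ₀ = w δ_a` (`w, a > 0`) is the K3-extremal shape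
(`M₋₁ = w/a = (wa)²/(wa³) = m₁²/m₃`) and has the least admissible fifth moment `w a⁵ = m₃²/m₁`
(`sq_thirdMoment_le_firstMoment_mul_fifthMoment`). For every admissible target `t ≥ w a⁵` and every `ε > 0` there is
a finite measure `ν` carried by `(0,∞)` with `|m₁(ν) − wa| ≤ ε`, `|m₃(ν) − wa³| ≤ ε`, `m₅(ν) = t` EXACTLY and
`M₋₁(ν) ≤ (wa)²/(wa³) + ε`. So a certified row on the fifth current moment (depth-5 nested commutator, degree ≤ 12
words), added to the K3 data `(d1U, m3T, m3U)`, cannot lift the correction to the stiffness ceiling above `m₁²/m₃`: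
the next odd level needs `m₅` AND `m₇` (`sq_oddPair_le_invMoment_mul`). [folklore] -/
theorem exists_fifthMoment_eq_invMoment_le_k3 {w a : ℝ} (hw : 0 < w) (ha : 0 < a) {t : ℝ}
    (ht : w * a ^ 5 ≤ t) {ε : ℝ} (hε : 0 < ε) :
    ∃ ν : Measure ℝ, IsFiniteMeasure ν ∧ ν (Iic 0) = 0 ∧
      |(∫ x, x ∂ν) - w * a| ≤ ε ∧ |(∫ x, x ^ 3 ∂ν) - w * a ^ 3| ≤ ε ∧ ∫ x, x ^ 5 ∂ν = t ∧
      ∫ x, x⁻¹ ∂ν ≤ (w * a) ^ 2 / (w * a ^ 3) + ε := by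
  set μ₀ : Measure ℝ := (Real.toNNReal w) • Measure.dirac a with hμ₀
  have hint : ∀ f : ℝ → ℝ, Integrable f μ₀ := fun f =>
    (integrable_dirac (by simp)).smul_measure_nnreal
  have hm : ∀ f : ℝ → ℝ, ∫ x, f x ∂μ₀ = w * f a := fun f => integral_pointMass hw.le a
  obtain ⟨w', b, hw', hb1, h5, hlow, hinv⟩ :=
    exists_raise_topMoment_invMoment_le μ₀ (hint _) 5 (hint _) (sub_nonneg.2 ht) hε
  refine ⟨μ₀ + (Real.toNNReal w') • Measure.dirac b, isFiniteMeasure_add_pointMass μ₀ w' b, ?_, ?_, ?_, ?_, ?_⟩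
  · have hb : 0 < b := one_pos.trans_le hb1
    exact add_pointMass_Iic_zero μ₀ (pointMass_Iic_zero w ha) w' hb
  · have h := hlow 1 (by norm_num) (hint _)
    simp only [pow_one] at h
    rwa [hm] at h
  · have h := hlow 3 (by norm_num) (hint _)
    rwa [hm (fun x => x ^ 3)] at h
  · rw [hm (fun x => x ^ 5)] at h5
    rw [h5]
    ring
  · refine hinv.trans ?_
    rw [hm (fun x => x⁻¹)]
    have : w * a⁻¹ = (w * a) ^ 2 / (w * a ^ 3) := by
      field_simp
    rw [this]

/-! ### The next level: the odd-pair (2-node Gauss) inequality — needs `m₅` AND `m₇` -/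

/-- Pointwise AM–GM behind the odd-pair bound: `2|φ| ≤ t x⁻¹ + φ² x / t` for `x, t > 0`, any real `φ`. [folklore] -/
theorem two_mul_abs_le_mul_inv_add_sq_mul_div {x t : ℝ} (hx : 0 < x) (ht : 0 < t) (φ : ℝ) :
    2 * |φ| ≤ t * x⁻¹ + φ ^ 2 * x / t := by
  have hx0 : x ≠ 0 := hx.ne'
  have ht0 : t ≠ 0 := ht.ne'
  have h1 : t * x⁻¹ + φ ^ 2 * x / t - 2 * φ = (t - φ * x) ^ 2 / (t * x) := by
    field_simp
    ring
  have h2 : t * x⁻¹ + φ ^ 2 * x / t + 2 * φ = (t + φ * x) ^ 2 / (t * x) := by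
    field_simp
    ring
  have h1' : 0 ≤ (t - φ * x) ^ 2 / (t * x) := by positivity
  have h2' : 0 ≤ (t + φ * x) ^ 2 / (t * x) := by positivity
  rcases le_or_gt 0 φ with hφ | hφ
  · rw [abs_of_nonneg hφ]
    linarith
  · rw [abs_of_neg hφ]
    linarith

/-- **What the next odd level buys — it needs `m₅` AND `m₇`.** For a finite measure `ν` carried by `(0,∞)` with
`x⁻¹, x, x³, x⁵, x⁷ ∈ L¹(ν)` and all real `α, β`:
`(α ∫x dν + β ∫x³ dν)² ≤ (∫ x⁻¹ dν)·(α² ∫x³ dν + 2αβ ∫x⁵ dν + β² ∫x⁷ dν)`,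
i.e. `(α m₁ + β m₃)² ≤ M₋₁ (α² m₃ + 2αβ m₅ + β² m₇)` (Cauchy–Schwarz with the odd trial vector; `β = 0` is the K3 row
`m₁² ≤ M₋₁ m₃`). Optimising `(α, β)` gives the 2-node Gauss floor `M₋₁ ≥ vᵀ[[m₃,m₅],[m₅,m₇]]⁻¹v`, `v = (m₁, m₃)`, strictly
above `m₁²/m₃` unless the current spectral measure is one atom — the first ceiling functional beyond K3 on a TL host, and it
requires the depth-7 commutator (`m₇`). [cite: Lipparini2008, §8.4 eqs. (8.30)–(8.33)] -/
theorem sq_oddPair_le_invMoment_mul (ν : Measure ℝ) [IsFiniteMeasure ν] (hpos : ν (Iic 0) = 0)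
    (hinv : Integrable (fun x : ℝ => x⁻¹) ν) (h1 : Integrable (fun x : ℝ => x) ν)
    (h3 : Integrable (fun x : ℝ => x ^ 3) ν) (h5 : Integrable (fun x : ℝ => x ^ 5) ν)
    (h7 : Integrable (fun x : ℝ => x ^ 7) ν) (α β : ℝ) :
    (α * ∫ x, x ∂ν + β * ∫ x, x ^ 3 ∂ν) ^ 2 ≤
      (∫ x, x⁻¹ ∂ν) * (α ^ 2 * ∫ x, x ^ 3 ∂ν + 2 * α * β * ∫ x, x ^ 5 ∂ν + β ^ 2 * ∫ x, x ^ 7 ∂ν) := by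
  have hae : ∀ᵐ x ∂ν, 0 < x := by
    have h := (measure_eq_zero_iff_ae_notMem (μ := ν) (s := Iic 0)).1 hpos
    filter_upwards [h] with x hx
    simpa using hx
  -- the odd trial function `φ = α x + β x³` and its weight `φ² x = α² x³ + 2αβ x⁵ + β² x⁷`
  set φ : ℝ → ℝ := fun x => α * x + β * x ^ 3 with hφ
  have hφint : Integrable φ ν := (h1.const_mul α).add (h3.const_mul β)
  have hφabs : Integrable (fun x => |φ x|) ν := hφint.abs
  have hwint : Integrable (fun x => φ x ^ 2 * x) ν := by
    have : (fun x => φ x ^ 2 * x) = fun x => α ^ 2 * x ^ 3 + 2 * α * β * x ^ 5 + β ^ 2 * x ^ 7 := by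
      funext x; simp only [hφ]; ring
    rw [this]
    exact ((h3.const_mul _).add (h5.const_mul _)).add (h7.const_mul _)
  have hφval : ∫ x, φ x ∂ν = α * ∫ x, x ∂ν + β * ∫ x, x ^ 3 ∂ν := by
    simp only [hφ]
    rw [integral_add (h1.const_mul α) (h3.const_mul β), integral_const_mul, integral_const_mul]
  have hwval : ∫ x, φ x ^ 2 * x ∂ν =
      α ^ 2 * ∫ x, x ^ 3 ∂ν + 2 * α * β * ∫ x, x ^ 5 ∂ν + β ^ 2 * ∫ x, x ^ 7 ∂ν := by
    have : (fun x => φ x ^ 2 * x) = fun x => α ^ 2 * x ^ 3 + 2 * α * β * x ^ 5 + β ^ 2 * x ^ 7 := by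
      funext x; simp only [hφ]; ring
    rw [this]
    have i3 : Integrable (fun x : ℝ => α ^ 2 * x ^ 3) ν := h3.const_mul _
    have i5 : Integrable (fun x : ℝ => 2 * α * β * x ^ 5) ν := h5.const_mul _
    have i7 : Integrable (fun x : ℝ => β ^ 2 * x ^ 7) ν := h7.const_mul _
    have i35 : Integrable (fun x : ℝ => α ^ 2 * x ^ 3 + 2 * α * β * x ^ 5) ν := i3.add i5
    rw [integral_add i35 i7, integral_add i3 i5, integral_const_mul, integral_const_mul,
      integral_const_mul]
  have hinv0 : 0 ≤ ∫ x, x⁻¹ ∂ν :=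
    integral_nonneg_of_ae (by filter_upwards [hae] with x hx; exact inv_nonneg.mpr hx.le)
  have hw0 : 0 ≤ ∫ x, φ x ^ 2 * x ∂ν :=
    integral_nonneg_of_ae (by filter_upwards [hae] with x hx; exact mul_nonneg (sq_nonneg _) hx.le)
  have habs0 : 0 ≤ ∫ x, |φ x| ∂ν := integral_nonneg fun x => abs_nonneg _
  -- `(∫|φ|)² ≤ M₋₁ · ∫ φ² x` by the two-term AM–GM family
  have hmain : (∫ x, |φ x| ∂ν) ^ 2 ≤ (∫ x, x⁻¹ ∂ν) * ∫ x, φ x ^ 2 * x ∂ν := by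
    refine sq_le_mul_of_forall_two_mul_le habs0 hinv0 hw0 fun t ht => ?_
    have hle : (fun x : ℝ => 2 * |φ x|) ≤ᵐ[ν] fun x => t * x⁻¹ + φ x ^ 2 * x / t := by
      filter_upwards [hae] with x hx
      exact two_mul_abs_le_mul_inv_add_sq_mul_div hx ht (φ x)
    have hint : Integrable (fun x : ℝ => t * x⁻¹ + φ x ^ 2 * x / t) ν :=
      (hinv.const_mul t).add (hwint.div_const t)
    have hmono := integral_mono_ae (hφabs.const_mul 2) hint hle
    rw [integral_const_mul, integral_add (hinv.const_mul t) (hwint.div_const t), integral_const_mul,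
      integral_div] at hmono
    linarith
  -- `|∫ φ| ≤ ∫ |φ|`
  have habs : |∫ x, φ x ∂ν| ≤ ∫ x, |φ x| ∂ν := abs_integral_le_integral_abs
  have hsq : (∫ x, φ x ∂ν) ^ 2 ≤ (∫ x, |φ x| ∂ν) ^ 2 := by
    rw [← sq_abs (∫ x, φ x ∂ν)]
    exact pow_le_pow_left₀ (abs_nonneg _) habs 2
  rw [← hφval, ← hwval]
  exact hsq.trans hmain

end Summit.Ventures.CertifiedManyBodySolver.Observables

end
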